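import Summits.BirchSwinnertonDyer.Rank1Residual.Additive.X3BranchLineCharacterPrimeDisc
import Mathlib.NumberTheory.LegendreSymbol.ZModChar
import HarnessLib

/-!
# X3: the character of a rational line whose kernel field is `ℚ(√2)` — `χ₈` (quadratic
# Kronecker–Weber at conductor `8`, via `√2 = ζ₈ + ζ₈⁻¹`), for the DISPLAY form of the certificate road
# (cell `bsd-eis`, seat `bsd-eis-x3` gen 3; route K1 `AdditiveBranchIMC` — supports only)

HONEST FRAMING (cell `bsd-eis`, `run/shared/lean/pub/bsd-eis/README.md` §4): THEOREMS ONLY; nothing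
booked. Complement of `X3BranchLineCharacterPrimeDisc.lean` for the kernel discriminant `D = 2` (e.g.
the record `2880i3`, `φ = χ_2`): `√2 = ζ₈ + ζ₈⁻¹ ∈ ℚ(ζ₈)` and `σ(√2) = χ₈(χ_8(σ))·√2` with Mathlib's
`ZMod.χ₈` (values `1, −1, −1, 1` at `1, 3, 5, 7`); then §3 of the sibling
(`X3Branch.smul_eq_quadraticCharacter_of_kernel_sqrt`) gives the action of `Γ_ℚ` on the line through
`χ₈ ∘ χ_8` read in `𝔽_p`.

* `Rat.exists_sqrt_two_smul_eq_chi8` — `∃ s, s ≠ 0 ∧ s² = 2 ∧ ∀ τ, τ • s = χ₈(χ_8(τ))·s`;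
* `X3Branch.smul_eq_chi8_of_kernel_sq_eq_two` — the line character for kernel field `ℚ(√2)`.

References: [Washington1997] Ch. 2–3 (`ℚ(√2) ⊂ ℚ(ζ₈)`); [IrelandRosen1990] Ch. 6 §1.
-/

set_option autoImplicit false

noncomputable section

open scoped Classical

namespace Summit.BirchSwinnertonDyer.Rank1Residual.Additive

open NumberField IsDedekindDomain Field WeierstrassCurve
  Literature.NumberTheory.GaloisRepresentations Literature.NumberTheory.EllipticCurves
  Literature.NumberTheory.EllipticCurves.Rank1Residual
  Summit.BirchSwinnertonDyer.Rank1Residual.X2.ResidualDevissageModules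
  Summit.BirchSwinnertonDyer.Rank1Residual.X2.ResidualDevissageLine
  Summit.BirchSwinnertonDyer.Rank1Residual.X2.PrimeOrderCharacters
  Summit.BirchSwinnertonDyer.Rank1Residual.X2.ResidualLineCharacters

/-- The values of `χ₈` on the units of `ℤ/8`, by the residue: `χ₈(c) = 1` if `c ∈ {1, 7}` and `−1` if
`c ∈ {3, 5}`; and the corresponding identity `ζ^c + ζ^{8−c}… ` is handled below. [folklore] -/
private theorem units_zmod_eight (u : (ZMod 8)ˣ) :
    (u : ZMod 8) = 1 ∨ (u : ZMod 8) = 3 ∨ (u : ZMod 8) = 5 ∨ (u : ZMod 8) = 7 := by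
  have key : ∀ v : (ZMod 8)ˣ, (v : ZMod 8) = 1 ∨ (v : ZMod 8) = 3 ∨ (v : ZMod 8) = 5 ∨ (v : ZMod 8) = 7 := by
    decide
  exact key u

/-- **`√2 = ζ₈ + ζ₈⁻¹` and `σ(√2) = χ₈(χ_8(σ))·√2`** (`ℚ(√2)` is the subfield of `ℚ(ζ₈)` fixed by
`{±1}`). [cite: Washington1997, Ch. 2 (quadratic subfields of cyclotomic fields)] -/
theorem Rat.exists_sqrt_two_smul_eq_chi8 :
    ∃ s : AlgebraicClosure ℚ, s ≠ 0 ∧ s ^ 2 = 2 ∧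
      ∀ τ : absoluteGaloisGroup ℚ,
        τ • s = ((ZMod.χ₈ (modNCyclotomicCharacter ℚ 8 τ : ZMod 8) : ℤ) : AlgebraicClosure ℚ) * s := by
  obtain ⟨ζ, hζ⟩ := HasEnoughRootsOfUnity.exists_primitiveRoot (AlgebraicClosure ℚ) 8
  have hζ8 : ζ ^ 8 = 1 := hζ.pow_eq_one
  -- `ζ⁴ = −1`
  have hζ4 : ζ ^ 4 = -1 := by
    have h4 : ζ ^ 4 ≠ 1 := hζ.pow_ne_one_of_pos_of_lt (by norm_num) (by norm_num)
    have hsq : ζ ^ 4 * ζ ^ 4 = 1 := by rw [← pow_add]; exact hζ8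
    rcases mul_self_eq_one_iff.mp hsq with h | h
    · exact absurd h h4
    · exact h
  set s : AlgebraicClosure ℚ := ζ + ζ ^ 7 with hs
  have hs2 : s ^ 2 = 2 := by
    have e1 : ζ ^ 7 = -ζ ^ 3 := by
      have : ζ ^ 7 = ζ ^ 4 * ζ ^ 3 := by ring
      rw [this, hζ4]; ring
    have e2 : ζ ^ 6 = -ζ ^ 2 := by
      have : ζ ^ 6 = ζ ^ 4 * ζ ^ 2 := by ring
      rw [this, hζ4]; ring
    calc s ^ 2 = ζ ^ 2 + 2 * ζ ^ 8 + ζ ^ 8 * ζ ^ 6 := by rw [hs]; ring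
      _ = 2 := by rw [hζ8, e2]; ring
  have hs0 : s ≠ 0 := by
    intro h0; rw [h0, zero_pow two_ne_zero] at hs2; exact two_ne_zero hs2.symm
  refine ⟨s, hs0, hs2, fun τ ↦ ?_⟩
  have hc := modNCyclotomicCharacter_spec ℚ 8 τ ζ hζ8
  set c : ℕ := ((modNCyclotomicCharacter ℚ 8 τ : (ZMod 8)ˣ) : ZMod 8).val with hcdef
  have hτs : τ • s = ζ ^ c + (ζ ^ c) ^ 7 := by
    rw [hs, smul_add, smul_pow', hc]
  rw [hτs]
  -- case analysis on the unit `χ_8(τ)`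
  have hval : ∀ {a : ZMod 8}, ((modNCyclotomicCharacter ℚ 8 τ : (ZMod 8)ˣ) : ZMod 8) = a → c = a.val := by
    intro a ha; rw [hcdef, ha]
  rcases units_zmod_eight (modNCyclotomicCharacter ℚ 8 τ) with h | h | h | h
  · rw [h, hval h]
    have : (ZMod.χ₈ (1 : ZMod 8) : ℤ) = 1 := by decide
    rw [this, show (1 : ZMod 8).val = 1 by decide, Int.cast_one, one_mul, pow_one, hs]
  · rw [h, hval h]
    have : (ZMod.χ₈ (3 : ZMod 8) : ℤ) = -1 := by decide
    rw [this, show (3 : ZMod 8).val = 3 by decide, Int.cast_neg, Int.cast_one, neg_one_mul, hs]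
    have e : (ζ ^ 3) ^ 7 = ζ ^ 5 := by
      rw [← pow_mul, show 3 * 7 = 8 * 2 + 5 by norm_num, pow_add, pow_mul, hζ8, one_pow, one_mul]
    rw [e]
    have e5 : ζ ^ 5 = -ζ := by
      have : ζ ^ 5 = ζ ^ 4 * ζ := by ring
      rw [this, hζ4]; ring
    have e3 : ζ ^ 3 = -ζ ^ 7 := by
      have : ζ ^ 7 = ζ ^ 4 * ζ ^ 3 := by ring
      rw [this, hζ4]; ring
    rw [e5, e3]; ring
  · rw [h, hval h]
    have : (ZMod.χ₈ (5 : ZMod 8) : ℤ) = -1 := by decide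
    rw [this, show (5 : ZMod 8).val = 5 by decide, Int.cast_neg, Int.cast_one, neg_one_mul, hs]
    have e : (ζ ^ 5) ^ 7 = ζ ^ 3 := by
      rw [← pow_mul, show 5 * 7 = 8 * 4 + 3 by norm_num, pow_add, pow_mul, hζ8, one_pow, one_mul]
    rw [e]
    have e5 : ζ ^ 5 = -ζ := by
      have : ζ ^ 5 = ζ ^ 4 * ζ := by ring
      rw [this, hζ4]; ring
    have e3 : ζ ^ 3 = -ζ ^ 7 := by
      have : ζ ^ 7 = ζ ^ 4 * ζ ^ 3 := by ring
      rw [this, hζ4]; ring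
    rw [e5, e3]; ring
  · rw [h, hval h]
    have : (ZMod.χ₈ (7 : ZMod 8) : ℤ) = 1 := by decide
    rw [this, show (7 : ZMod 8).val = 7 by decide, Int.cast_one, one_mul, hs]
    have e : (ζ ^ 7) ^ 7 = ζ := by
      rw [← pow_mul, show 7 * 7 = 8 * 6 + 1 by norm_num, pow_add, pow_mul, hζ8, one_pow, one_mul,
        pow_one]
    rw [e, add_comm]

variable {W : WeierstrassCurve ℚ} {p : ℕ} [hp : Fact p.Prime]
  {Φ₀ : AddSubgroup (geomTorsion W (p : ℤ))} (hΦ : IsRationalLine W p Φ₀)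

include hΦ in
/-- **The line character for kernel field `ℚ(√2)`**: if `σ` fixes the rational line `Φ₀` pointwise iff
it fixes some `g` with `g² = 2`, then `Γ_ℚ` acts on `Φ₀` through `χ₈ ∘ χ_8` read in `𝔽_p`.
[cite: Washington1997, Ch. 2–3] [cite: GreenbergVatsal2000, §2 p. 28 (the character φ of Φ)] -/
theorem X3Branch.smul_eq_chi8_of_kernel_sq_eq_two {g : AlgebraicClosure ℚ} (hg : g ^ 2 = 2)
    (hker : ∀ σ : absoluteGaloisGroup ℚ, (∀ Q ∈ Φ₀, σ • Q = Q) ↔ σ • g = g)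
    (σ : absoluteGaloisGroup ℚ) (P : geomTorsion W (p : ℤ)) (hP : P ∈ Φ₀) :
    σ • P = ((ZMod.χ₈.ringHomComp (Int.castRingHom (ZMod p)) : DirichletCharacter (ZMod p) 8)
        ((modNCyclotomicCharacter ℚ 8 σ : (ZMod 8)ˣ) : ZMod 8)).val • P := by
  obtain ⟨s, hs0, hs2, hs⟩ := Rat.exists_sqrt_two_smul_eq_chi8
  have hgs : g = s ∨ g = -s := by
    have h : (g - s) * (g + s) = 0 := by
      have : g ^ 2 = s ^ 2 := by rw [hg, hs2]
      linear_combination this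
    rcases mul_eq_zero.mp h with h1 | h1
    · exact Or.inl (by linear_combination h1)
    · exact Or.inr (by linear_combination h1)
  have hker' : ∀ σ : absoluteGaloisGroup ℚ, (∀ Q ∈ Φ₀, σ • Q = Q) ↔ σ • s = s := by
    intro τ
    rw [hker τ]
    rcases hgs with rfl | rfl
    · exact Iff.rfl
    · rw [smul_neg, neg_inj]
  exact X3Branch.smul_eq_quadraticCharacter_of_kernel_sqrt hΦ ZMod.χ₈ ZMod.isQuadratic_χ₈ hs0 hs hker'
    σ P hP

end Summit.BirchSwinnertonDyer.Rank1Residual.Additive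

end
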